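import Summits.BirchSwinnertonDyer.BirchSwinnertonDyer.Theorems.ResidualThetaTransportAtTwoResidualSignedLambdaLowerCMAtTwoStationRValVisible
import HarnessLib

/-!
# Station (R) step D′ kit (forward half), §D/§E: (R₀) in the v3g currency `S = range ι` off the binder `IsPollackPairK g ι Ω Lp Lm`, `(H-FIN) ⟹ (H-RIG)`,
# and QUANTITATIVE WILDNESS — the value vector of a Kato valued class is VAL-visible (`S_w(ψ) ≠ 0`) at EVERY even primitive `ψ` of large conductor

Route `ResidualThetaTransportAtTwo` (RTT), crux RSL_g `ResidualSignedLambdaLowerCMAtTwo` (stmt-BirchSwinnertonDyer-22608), line «onepair» v3g,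
registered KERNEL stub `stub_kzgValueRelation` = station (R) — its load-bearing STEP D′ `π.cvec z ≠ 0` for a Kato valued class (STUB-PLAN rev 29,
S155/T90; port lane of the (R) writer `prover-bsd-wall-tp2-p2x-w3` g18, who consumes this file by name). Width seat `prover-bsd-wall-tp2-p2x-w2` g22
(`--supports 22608 --as helper`, closes nothing). THEOREMS ONLY (no `def`, no instance, no notation, no named fact, no `sorry`). BSD is NOT proved by
any of this; 22608 / 26074 / 24105 stay OPEN / HOLD; nothing here asserts child A / child B / (R).

PORT of the kernel-checked sketch `Cruxes/ResidualThetaCountLowerPureAtTwo/Sketch_sidea_k4_g26.lean` v2 (stub-ideation k4 g26 «assume the opposite: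
the degenerate instances of station (R)»; STUB-PLAN rev 29 row 105), statements and proofs VERBATIM up to the namespace (the zero-tuple audit §A/§A′/§B
of the sketch is not ported); credit: stub-ideation k4 g26 (every statement and proof). The displayed helper hypotheses (H-RIG) / (H-FIN) stay
hypotheses exactly as in the sketch ((H-RIG) = `StationR.Road.eq_zero_of_forall_primitive_tsum_eq_zero`, p722826, discharged by the consumer).

References: [Pollack2003] Cor. 5.11, Prop. 6.18; [Kato2004Asterisque] Thm. 12.5 (1) (pp. 221–222), §15.16 (p. 265); [Washington1997] §7.1 Thm. 7.3.
-/

set_option autoImplicit false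
-- the Theorems namespace of this sub repeats the summit name by design (D-0017 nested layout)
set_option linter.dupNamespace false
set_option backward.isDefEq.respectTransparency false

noncomputable section

open scoped Classical NumberField

open Polynomial
open Literature.NumberTheory.EllipticCurves Literature.NumberTheory.EllipticCurves.GreenbergSelmer
open Literature.NumberTheory.EllipticCurves.ModularForms
open Literature.NumberTheory.GaloisRepresentations NumberField IsDedekindDomain Field
open GreenbergVatsal2000 Kobayashi2003 Rat.HeightOneSpectrum
open Summit.BirchSwinnertonDyer.Rank1Residual.Additive Summit.BirchSwinnertonDyer.Rank1Residual.Additive.PadicCyclotomicTower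
open Summit.BirchSwinnertonDyer.BirchSwinnertonDyer.Theorems.OnePair
open Summit.BirchSwinnertonDyer.BirchSwinnertonDyer.Theorems

namespace Summit.BirchSwinnertonDyer.BirchSwinnertonDyer.Theorems.ThetaTransport.StationRValVisible

variable {M : ℕ} [NeZero M] (g : CuspForm (CongruenceSubgroup.Gamma0 M) 2) (ι : coeffField g →+* PadicAlgCl 2) (Ω : ℂ)

variable {S : Set (PadicAlgCl 2)} {W : WeierstrassCurve ℚ} [W.IsElliptic] {κ : ZpExtension ℚ 2} {γ : absoluteGaloisGroup ℚ}
  {S₀ : Finset (HeightOneSpectrum (𝓞 ℚ))} {n : ℕ} {ρ : FramedGaloisRep ℚ ↥(padicCoeffIntegers S) 2}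
  {Θ : ∀ v : HeightOneSpectrum (𝓞 ℚ), ((2 : ℕ) : 𝓞 ℚ) ∈ v.asIdeal → (Cofree ρ ↥(padicCoeffField S) ≃+ (Fin n → ↥(W.geomPrimaryTorsion 2)))}
  {hΘ : ∀ v hv (δ : absoluteGaloisGroup (v.adicCompletion ℚ)) m i,
    Θ v hv (resGalOfEmb (closureEmb (K := ℚ) (v.adicCompletion ℚ)) δ • m) i = resGalOfEmb (closureEmb (K := ℚ) (v.adicCompletion ℚ)) δ • Θ v hv m i}
  {I : Kato2004.IwasawaH1DataCoeff (FramedGaloisRep.toGaloisRep ρ) 2 κ γ}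
  {Sg : AddSubgroup (subgroupH1 κ.kerSubgroup (Cofree ρ ↥(padicCoeffField S)))} [Module ↥(padicCoeffIntegers S) ↥Sg]
  (π : OnePairPins S W κ γ S₀ n ρ Θ hΘ I Sg)


/-! ## §D The v3f currency: `S := range ι`, the hypotheses read off the Pollack-pair BINDER of RSL_g (`IsPollackPairK g ι Ω Lp Lm`) -/

/-- **(R₀) in the one-pair bundle's own currency (S138 in kernel).** On `S = range ι`, with the binder `IsPollackPairK g ι Ω Lp Lm` of
RSL_g's text (`.2.1 : L⁻ ≠ 0`, `.2.2.2` = the even congruences) and the rigidity lemma (H-RIG) of the evaluation road, NO tuple with value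
vector `w = 0` is a Kato valued class of child A — for ANY class `z` and ANY multiplier `μt`; in particular k1-g25 F3's junk tuple
`(0, c′, 0, 1, T)` is excluded by (VALρ) + the binder, exactly as S138 words it. [cite: Kato2004Asterisque, Thm. 12.5 (1) (pp. 221–222)]
[cite: Pollack2003, Cor. 5.11, Prop. 6.18 (proof)] -/
theorem not_katoValuedClass_w_zero_of_isPollackPairK [W.IsGloballyMinimal]
    {ρ₁ : FramedGaloisRep ℚ ↥(padicCoeffIntegers (Set.range ι)) 2}
    {Θ₁ : ∀ v : HeightOneSpectrum (𝓞 ℚ), ((2 : ℕ) : 𝓞 ℚ) ∈ v.asIdeal →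
      (Cofree ρ₁ ↥(padicCoeffField (Set.range ι)) ≃+ (Fin n → ↥(W.geomPrimaryTorsion 2)))}
    {hΘ₁ : ∀ v hv (δ : absoluteGaloisGroup (v.adicCompletion ℚ)) m i,
      Θ₁ v hv (resGalOfEmb (closureEmb (K := ℚ) (v.adicCompletion ℚ)) δ • m) i =
        resGalOfEmb (closureEmb (K := ℚ) (v.adicCompletion ℚ)) δ • Θ₁ v hv m i}
    {I₁ : Kato2004.IwasawaH1DataCoeff (FramedGaloisRep.toGaloisRep ρ₁) 2 κ γ}
    {Sg₁ : AddSubgroup (subgroupH1 κ.kerSubgroup (Cofree ρ₁ ↥(padicCoeffField (Set.range ι))))}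
    [Module ↥(padicCoeffIntegers (Set.range ι)) ↥Sg₁]
    (π₁ : OnePairPins (Set.range ι) W κ γ S₀ n ρ₁ Θ₁ hΘ₁ I₁ Sg₁)
    {Lp Lm : IwasawaAlgebraO (Set.range ι)} (hL : IsPollackPairK g ι Ω Lp Lm)
    (hRIG : ∀ (G : IwasawaAlgebraO (Set.range ι)) (ℓ : ℕ → ℕ), (∀ m : ℕ, ∃ i, m < ℓ i) →
      (∀ (i : ℕ) (ζ : ℂ_[2]), IsPrimitiveRoot ζ (2 ^ (ℓ i + 1)) →
        ∑' k, ((algebraMap (PadicAlgCl 2) ℂ_[2]).comp (padicCoeffIntegers (Set.range ι)).subtype) (PowerSeries.coeff k G) *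
          (ζ - 1) ^ k = 0) → G = 0)
    (Φ : AlgebraicClosure ℚ_[2] ≃ₐ[ℚ] AlgebraicClosure (π₁.v.adicCompletion ℚ))
    (τ : ∀ m : ℕ, ZMod (2 ^ m) → Field.absoluteGaloisGroup ℚ_[2]) (z : I₁.H) (c' : Fin n → ↥(padicCoeffIntegers (Set.range ι)))
    (q : PadicAlgCl 2) (μt : IwasawaAlgebraO (Set.range ι)) :
    ¬ π₁.KatoValuedClass g ι Ω Φ τ z c' 0 q μt :=
  not_katoValuedClass_w_zero g ι Ω π₁ hL.2.1 (fun N hN ↦ hL.2.2.2 N hN) hRIG Φ τ z c' q μt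

/-- **Station (R) on the slice `w = 0`, in the v3f currency** (vacuous: the guard is never met). [cite: Kato2004Asterisque, Thm. 12.5 (1)–(2)] -/
theorem stationR_at_w_zero_of_isPollackPairK [W.IsGloballyMinimal]
    {ρ₁ : FramedGaloisRep ℚ ↥(padicCoeffIntegers (Set.range ι)) 2}
    {Θ₁ : ∀ v : HeightOneSpectrum (𝓞 ℚ), ((2 : ℕ) : 𝓞 ℚ) ∈ v.asIdeal →
      (Cofree ρ₁ ↥(padicCoeffField (Set.range ι)) ≃+ (Fin n → ↥(W.geomPrimaryTorsion 2)))}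
    {hΘ₁ : ∀ v hv (δ : absoluteGaloisGroup (v.adicCompletion ℚ)) m i,
      Θ₁ v hv (resGalOfEmb (closureEmb (K := ℚ) (v.adicCompletion ℚ)) δ • m) i =
        resGalOfEmb (closureEmb (K := ℚ) (v.adicCompletion ℚ)) δ • Θ₁ v hv m i}
    {I₁ : Kato2004.IwasawaH1DataCoeff (FramedGaloisRep.toGaloisRep ρ₁) 2 κ γ}
    {Sg₁ : AddSubgroup (subgroupH1 κ.kerSubgroup (Cofree ρ₁ ↥(padicCoeffField (Set.range ι))))}
    [Module ↥(padicCoeffIntegers (Set.range ι)) ↥Sg₁]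
    (π₁ : OnePairPins (Set.range ι) W κ γ S₀ n ρ₁ Θ₁ hΘ₁ I₁ Sg₁)
    {Lp Lm : IwasawaAlgebraO (Set.range ι)} (hL : IsPollackPairK g ι Ω Lp Lm)
    (hRIG : ∀ (G : IwasawaAlgebraO (Set.range ι)) (ℓ : ℕ → ℕ), (∀ m : ℕ, ∃ i, m < ℓ i) →
      (∀ (i : ℕ) (ζ : ℂ_[2]), IsPrimitiveRoot ζ (2 ^ (ℓ i + 1)) →
        ∑' k, ((algebraMap (PadicAlgCl 2) ℂ_[2]).comp (padicCoeffIntegers (Set.range ι)).subtype) (PowerSeries.coeff k G) *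
          (ζ - 1) ^ k = 0) → G = 0)
    (Φ : AlgebraicClosure ℚ_[2] ≃ₐ[ℚ] AlgebraicClosure (π₁.v.adicCompletion ℚ))
    (τ : ∀ m : ℕ, ZMod (2 ^ m) → Field.absoluteGaloisGroup ℚ_[2]) (z : I₁.H) (c' : Fin n → ↥(padicCoeffIntegers (Set.range ι)))
    (q : PadicAlgCl 2) (μt : IwasawaAlgebraO (Set.range ι)) (hcl : π₁.KatoValuedClass g ι Ω Φ τ z c' 0 q μt)
    (e : (Fin n → PowerSeries ℤ_[2]) ≃+ IwasawaAlgebraO (Set.range ι)) :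
    ∃ (ν : ↥(padicCoeffIntegers (Set.range ι))) (u : IwasawaAlgebraO (Set.range ι)), ν ≠ 0 ∧ u ≠ 0 ∧
      PowerSeries.C ν * e (π₁.cvec z) = μt * (Lm * u) :=
  (not_katoValuedClass_w_zero_of_isPollackPairK g ι Ω π₁ hL hRIG Φ τ z c' q μt hcl).elim

/-! ## §E Quantitative wildness: `(H-FIN) ⟹ (H-RIG)` and «a Kato valued class is VAL-visible at EVERY large level» (odd levels via `L⁺`, even via `L⁻`) -/

/-- **(H-FIN) ⟹ (H-RIG) (PROVED).** Finiteness of the cyclotomic zeros of a nonzero element of `Λ_𝒪` — displayed here in the «eventually along the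
levels» form (H-FIN): `G ≠ 0 ⟹ ∃ N₀ ∀ N ≥ N₀ ∀ ζ of exact order 2^N, G(ζ − 1) ≠ 0` (Weierstrass preparation over `𝒪⟦T⟧`; the tree has the
`ℤ_p`-pattern `MemIwasawaRat.finite_setOf_hasSum_zero`, the `𝒪`-port is plan helper (H-FIN)) — implies the rigidity hypothesis (H-RIG) of §C
(primitive `2^m`-th roots exist in `ℚ̄₂ ⊂ ℂ₂`: `PadicCyclotomicTower.isPrimitiveRoot_zeta`). So every §C/§D statement holds under (H-FIN) alone.
[cite: Washington1997, §7.1 Thm. 7.3, Prop. 7.2] -/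
theorem hRIG_of_hFIN
    (hFIN : ∀ G : IwasawaAlgebraO S, G ≠ 0 → ∃ N₀ : ℕ, ∀ N : ℕ, N₀ ≤ N → ∀ ζ : ℂ_[2], IsPrimitiveRoot ζ (2 ^ N) →
      ∑' k, ((algebraMap (PadicAlgCl 2) ℂ_[2]).comp (padicCoeffIntegers S).subtype) (PowerSeries.coeff k G) * (ζ - 1) ^ k ≠ 0) :
    ∀ (G : IwasawaAlgebraO S) (ℓ : ℕ → ℕ), (∀ m : ℕ, ∃ i, m < ℓ i) →
      (∀ (i : ℕ) (ζ : ℂ_[2]), IsPrimitiveRoot ζ (2 ^ (ℓ i + 1)) →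
        ∑' k, ((algebraMap (PadicAlgCl 2) ℂ_[2]).comp (padicCoeffIntegers S).subtype) (PowerSeries.coeff k G) * (ζ - 1) ^ k = 0) →
      G = 0 := by
  intro G ℓ hℓ h
  by_contra hG
  obtain ⟨N₀, hN₀⟩ := hFIN G hG
  obtain ⟨i, hi⟩ := hℓ N₀
  have hζ : IsPrimitiveRoot (algebraMap (PadicAlgCl 2) ℂ_[2] (PadicCyclotomicTower.zeta 2 (ℓ i + 1))) (2 ^ (ℓ i + 1)) :=
    (PadicCyclotomicTower.isPrimitiveRoot_zeta 2 (ℓ i + 1)).map_of_injective (algebraMap (PadicAlgCl 2) ℂ_[2]).injective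
  exact hN₀ (ℓ i + 1) (by omega) _ hζ (h i _ hζ)

/-- **A KATO VALUED CLASS IS VAL-VISIBLE AT EVERY LARGE LEVEL (PROVED mod (H-FIN)).** With a full signed pair — `L⁺ ≠ 0`, `L⁻ ≠ 0`, the odd
congruences `θ_N ≡ ±ω⁺_N L⁺` and the even ones `θ_N ≡ ±ω⁻_N L⁻ (mod ω_N)` (= the four components of RSL_g's binder `IsPollackPairK g ι Ω Lp Lm`) —
and (H-FIN), the value vector `w` of any Kato valued class `(z, c′, w, q, μt)` has NON-VANISHING twisted Galois sum `S_w(ψ) ≠ 0` at EVERY even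
primitive `ψ` of conductor `2^{N+2}` for all `N ≥ N₀(μt, L⁺, L⁻)` — odd AND even `N`. This is the quantitative form of §C's wildness and exactly
the value-side input «`w_σ(ψ_ζ) ≠ 0` for `m ≥ m₀`» that the (R) supplier's unit step (w3 g18 F3) and `stub_kzgValueRelation`'s `ν ≠ 0` consume.
[cite: Kato2004Asterisque, Thm. 12.5 (1) (pp. 221–222)] [cite: Pollack2003, Cor. 5.11, Prop. 6.18 (proof)] [cite: Washington1997, §7.1 Thm. 7.3] -/
theorem eventually_twistedSum_ne_zero_of_katoValuedClass [W.IsGloballyMinimal]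
    {Lp Lm : IwasawaAlgebraO S} (hLp : Lp ≠ 0) (hLm : Lm ≠ 0)
    (hcongOdd : ∀ N : ℕ, Odd N →
      IsCongrModOmegaO S N ((mazurTateElementK g Ω 2 N).map ι)
        (((((-1 : ℤ[X]) ^ (N / 2 + 1) * cyclotomicOmegaPlus 2 N).map (Int.castRingHom (PadicAlgCl 2)) : (PadicAlgCl 2)[X]) :
            PowerSeries (PadicAlgCl 2)) * iwasawaOToPowerSeries S Lp))
    (hcongEven : ∀ N : ℕ, Even N →
      IsCongrModOmegaO S N ((mazurTateElementK g Ω 2 N).map ι)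
        (((((-1 : ℤ[X]) ^ (N / 2 + 1) * cyclotomicOmegaMinus 2 N).map (Int.castRingHom (PadicAlgCl 2)) : (PadicAlgCl 2)[X]) :
            PowerSeries (PadicAlgCl 2)) * iwasawaOToPowerSeries S Lm))
    (hFIN : ∀ G : IwasawaAlgebraO S, G ≠ 0 → ∃ N₀ : ℕ, ∀ N : ℕ, N₀ ≤ N → ∀ ζ : ℂ_[2], IsPrimitiveRoot ζ (2 ^ N) →
      ∑' k, ((algebraMap (PadicAlgCl 2) ℂ_[2]).comp (padicCoeffIntegers S).subtype) (PowerSeries.coeff k G) * (ζ - 1) ^ k ≠ 0)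
    {Φ : AlgebraicClosure ℚ_[2] ≃ₐ[ℚ] AlgebraicClosure (π.v.adicCompletion ℚ)}
    {τ : ∀ m : ℕ, ZMod (2 ^ m) → Field.absoluteGaloisGroup ℚ_[2]} {z : I.H} {c' : Fin n → ↥(padicCoeffIntegers S)}
    {w : ℕ → Fin π.nb → PadicAlgCl 2} {q : PadicAlgCl 2} {μt : IwasawaAlgebraO S}
    (hcl : π.KatoValuedClass g ι Ω Φ τ z c' w q μt) :
    ∃ N₀ : ℕ, ∀ N : ℕ, N₀ ≤ N → ∀ ψ : DirichletCharacter (PadicAlgCl 2) (2 ^ (N + 2)), ψ (-1) = 1 → ψ.IsPrimitive →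
      ∑ j : Fin π.nb, ((π.bO j : ↥(padicCoeffIntegers S)) : PadicAlgCl 2) *
          ∑ b : (ZMod (2 ^ (N + 2)))ˣ, ψ⁻¹ (b : ZMod (2 ^ (N + 2))) * τ (N + 2) (b : ZMod (2 ^ (N + 2))) • w (N + 2) j ≠ 0 := by
  obtain ⟨hq, hμ, -, -, hVAL, -⟩ := hcl
  obtain ⟨Np, hNp⟩ := hFIN (μt * Lp) (mul_ne_zero hμ hLp)
  obtain ⟨Nm, hNm⟩ := hFIN (μt * Lm) (mul_ne_zero hμ hLm)
  refine ⟨Np + Nm + 1, fun N hN ψ hψe hψp hS ↦ ?_⟩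
  have hN1 : 1 ≤ N := by omega
  have hζ := isPrimitiveRoot_apply_five hN1 ψ hψe hψp
  rcases Nat.even_or_odd N with hNe | hNo
  · exact hNm N (by omega) _ hζ
      (tsum_coeff_mul_eq_zero_of_twistedSum_eq_zero g ι Ω π hN1 (hcongEven N hNe) τ hq hVAL ψ hψe hψp
        (eval₂_signedOmegaMinus_ne_zero hNe hζ) hS)
  · exact hNp N (by omega) _ hζ
      (tsum_coeff_mul_eq_zero_of_twistedSum_eq_zero g ι Ω π hN1 (hcongOdd N hNo) τ hq hVAL ψ hψe hψp
        (eval₂_signedOmegaPlus_ne_zero hNo hζ) hS)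

/-- **The same in the v3f currency** (`S = range ι`; all four hypotheses read off RSL_g's binder `IsPollackPairK g ι Ω Lp Lm`): modulo (H-FIN),
the value vector of a Kato valued class of child A is VAL-visible at every level `N ≥ N₀`. [cite: Pollack2003, Cor. 5.11, Prop. 6.18]
[cite: Kato2004Asterisque, Thm. 12.5 (1) (pp. 221–222)] -/
theorem eventually_twistedSum_ne_zero_of_isPollackPairK [W.IsGloballyMinimal]
    {ρ₁ : FramedGaloisRep ℚ ↥(padicCoeffIntegers (Set.range ι)) 2}
    {Θ₁ : ∀ v : HeightOneSpectrum (𝓞 ℚ), ((2 : ℕ) : 𝓞 ℚ) ∈ v.asIdeal →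
      (Cofree ρ₁ ↥(padicCoeffField (Set.range ι)) ≃+ (Fin n → ↥(W.geomPrimaryTorsion 2)))}
    {hΘ₁ : ∀ v hv (δ : absoluteGaloisGroup (v.adicCompletion ℚ)) m i,
      Θ₁ v hv (resGalOfEmb (closureEmb (K := ℚ) (v.adicCompletion ℚ)) δ • m) i =
        resGalOfEmb (closureEmb (K := ℚ) (v.adicCompletion ℚ)) δ • Θ₁ v hv m i}
    {I₁ : Kato2004.IwasawaH1DataCoeff (FramedGaloisRep.toGaloisRep ρ₁) 2 κ γ}
    {Sg₁ : AddSubgroup (subgroupH1 κ.kerSubgroup (Cofree ρ₁ ↥(padicCoeffField (Set.range ι))))}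
    [Module ↥(padicCoeffIntegers (Set.range ι)) ↥Sg₁]
    (π₁ : OnePairPins (Set.range ι) W κ γ S₀ n ρ₁ Θ₁ hΘ₁ I₁ Sg₁)
    {Lp Lm : IwasawaAlgebraO (Set.range ι)} (hL : IsPollackPairK g ι Ω Lp Lm)
    (hFIN : ∀ G : IwasawaAlgebraO (Set.range ι), G ≠ 0 → ∃ N₀ : ℕ, ∀ N : ℕ, N₀ ≤ N → ∀ ζ : ℂ_[2], IsPrimitiveRoot ζ (2 ^ N) →
      ∑' k, ((algebraMap (PadicAlgCl 2) ℂ_[2]).comp (padicCoeffIntegers (Set.range ι)).subtype) (PowerSeries.coeff k G) *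
        (ζ - 1) ^ k ≠ 0)
    {Φ : AlgebraicClosure ℚ_[2] ≃ₐ[ℚ] AlgebraicClosure (π₁.v.adicCompletion ℚ)}
    {τ : ∀ m : ℕ, ZMod (2 ^ m) → Field.absoluteGaloisGroup ℚ_[2]} {z : I₁.H} {c' : Fin n → ↥(padicCoeffIntegers (Set.range ι))}
    {w : ℕ → Fin π₁.nb → PadicAlgCl 2} {q : PadicAlgCl 2} {μt : IwasawaAlgebraO (Set.range ι)}
    (hcl : π₁.KatoValuedClass g ι Ω Φ τ z c' w q μt) :
    ∃ N₀ : ℕ, ∀ N : ℕ, N₀ ≤ N → ∀ ψ : DirichletCharacter (PadicAlgCl 2) (2 ^ (N + 2)), ψ (-1) = 1 → ψ.IsPrimitive →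
      ∑ j : Fin π₁.nb, ((π₁.bO j : ↥(padicCoeffIntegers (Set.range ι))) : PadicAlgCl 2) *
          ∑ b : (ZMod (2 ^ (N + 2)))ˣ, ψ⁻¹ (b : ZMod (2 ^ (N + 2))) * τ (N + 2) (b : ZMod (2 ^ (N + 2))) • w (N + 2) j ≠ 0 :=
  eventually_twistedSum_ne_zero_of_katoValuedClass g ι Ω π₁ hL.1 hL.2.1 (fun N hN ↦ hL.2.2.1 N hN) (fun N hN ↦ hL.2.2.2 N hN) hFIN hcl


end Summit.BirchSwinnertonDyer.BirchSwinnertonDyer.Theorems.ThetaTransport.StationRValVisible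

end
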